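import Literature.Analysis.FluidPDE.PassiveScalarForcedRenormalizedLimits
import HarnessLib

/-!
# Conservative energy balance of SOURCED transport equations with Lipschitz drift

Analysis/FluidPDE proof-support file (everything proved). For a weak solution
`θ ∈ L^∞(0,T; L²(T^d))` of the steadily sourced TRANSPORT equation `∂ₜθ + W·∇θ = f` on
`T^d × [0,T)` — the class `Torus.IsWeakScalarTransportForcedOn T 0 W (fun _ => f) θ₀ θ` with
`κ = 0`, which contains the weak incompressibility of `W(t)` for a.e. `t` — whose drift `W` is
`L`-Lipschitz in space at every time, with `θ₀ ∈ L²` and `f` smooth, the energy is conserved up to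
the work of the source:

  `‖θ(t)‖²_{L²} = ‖θ₀‖²_{L²} + 2 ∫_{(0,t]} ∫ θ f`   for a.e. `t ∈ (0,T)`

(`IsWeakScalarTransportForcedOn.integral_sq_eq_of_lipschitzWith`). This is DiPerna–Lions 1989,
§II.3, Thm. II.3 (renormalised solutions of transport equations with `W^{1,1}` drifts conserve
`∫ β(θ)`), in the classical Lipschitz setting of the tree's commutator lemmas
(`PassiveScalarProofs`, §Commutator), and the `κ = 0` companion of the energy inequality of
`PassiveScalarForcedEnergy`.

## Proof

The renormalised mollified identity `IsWeakScalarTransportForcedOn.ae_integral_comp_molInt_eq`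
(`PassiveScalarForcedRenormalized`) with `κ = 0`, `β = β_M = Calculus.renorm M` and the kernels
`kₙ = Torus.kernel εₙ`, `εₙ = 1/(4(n+1))`, reads, with `Aₙ = θ ⋆ kₙ`,
`∫ β_M(Aₙ(t)) = ∫ β_M(θ₀ ⋆ kₙ) + ∫_{(0,t]} ∫ β_M'(Aₙ)(Gₙ + f ⋆ kₙ)` for a.e. `t`, where the flux is
`Gₙ = rₙ - ⟪W, ∇Aₙ⟫` with the DiPerna–Lions commutator `rₙ`; weak incompressibility kills
`∫ β_M'(Aₙ)⟪W, ∇Aₙ⟫ = ∫ ⟪W, ∇(β_M ∘ Aₙ)⟫` (`Torus.integral_deriv_comp_mul_flux_eq`,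
`PassiveScalarRenormalizedSlice`), and the Lipschitz commutator estimate
`‖rₙ(τ)‖_{L²} ≤ L C ‖θ(τ)‖_{L²}`, `‖rₙ(τ)‖_{L²} → 0` (`Torus.eLpNorm_comm_le`,
`Torus.tendsto_eLpNorm_comm`) gives `∫_{(0,T)} ‖rₙ‖_{L¹} → 0` by dominated convergence
(`comm_decay_of_lipschitzWith`). Letting `n → ∞` at a.e. `t` (`Aₙ(t) → θ(t)` in `L²`, `β_M`
Lipschitz, `f ⋆ kₙ → f` uniformly; `PassiveScalarForcedRenormalizedLimits`) yields
`∫ β_M(θ(t)) = ∫ β_M(θ₀) + ∫_{(0,t]} ∫ β_M'(θ) f` for every `M ∈ ℕ`, and `M → ∞` by dominated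
convergence (`0 ≤ β_M ≤ y²`, `|β_M'| ≤ 2|y|`) gives the EQUALITY — there is no dissipation term and
no semicontinuity step.

## References

* R. J. DiPerna, P.-L. Lions, *Ordinary differential equations, transport theory and Sobolev
  spaces*, Invent. Math. 98 (1989), 511–547, §II.1 Lemma II.1, §II.3 Thm. II.3. [`DiPernaLions1989`]
* L. Ambrosio, G. Crippa, *Continuity equations and ODE flows with non-smooth velocity*,
  Proc. Roy. Soc. Edinburgh 144A (2014), 1191–1244, §4, Thm. 4.6 (the commutator estimate).
  [`AmbrosioCrippa2014`]
-/

noncomputable section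

open MeasureTheory TopologicalSpace Set Function Filter Topology Metric ContinuousLinearMap
  UnitAddTorus
open scoped ENNReal NNReal Convolution ContDiff InnerProductSpace

namespace Literature.Analysis.FluidPDE

namespace Torus

variable {d : Type*} [Fintype d]

namespace IsWeakScalarTransportForcedOn

/-! ## The Lipschitz commutator along a weak solution -/

/-- **Decay of the DiPerna–Lions commutator along a weak solution with Lipschitz drift.** For a
weak solution `θ ∈ L^∞(0,T;L²)` of the sourced passive scalar equation whose drift `W(t)` is
`L`-Lipschitz at every time and mollifiers `kₙ = Torus.kernel εₙ` (`0 < εₙ ≤ 1/4`, `εₙ → 0`),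
the commutators `rₙ(τ, x) = ∫ θ(τ,y) ⟪W(τ,x) - W(τ,y), ∇kₙ(x-y)⟫ dy` satisfy
`‖rₙ(τ)‖_{L¹} ≤ ‖rₙ(τ)‖_{L²} ≤ L C₁ sup_τ ‖θ(τ)‖_{L²} =: K` for a.e. `τ` and
`∫_{(0,T)} ‖rₙ(τ)‖_{L¹} dτ → 0` (`eLpNorm_comm_le`, `tendsto_eLpNorm_comm` at the a.e.
`τ` where `div W(τ) = 0` weakly, dominated convergence in `τ`; DiPerna–Lions 1989, Lemma II.1;
Ambrosio–Crippa 2014, Thm. 4.6). [cite: AmbrosioCrippa2014, §4, Thm. 4.6 and (4.6)] -/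
theorem comm_decay_of_lipschitzWith {T κ : ℝ} {L : ℝ≥0} {W : ℝ → UnitAddTorus d → EuclideanSpace ℝ d}
    {s : ℝ → UnitAddTorus d → ℝ} {θ₀ : UnitAddTorus d → ℝ} {θ : ℝ → UnitAddTorus d → ℝ}
    (h : IsWeakScalarTransportForcedOn T κ W s θ₀ θ) (hW : ∀ t, LipschitzWith L (W t))
    {ε : ℕ → ℝ} (hε : ∀ n, 0 < ε n) (hε' : ∀ n, ε n ≤ 1 / 4) (hε0 : Tendsto ε atTop (𝓝 0)) :
    ∃ K : ℝ≥0,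
      (∀ n, ∀ᵐ τ ∂(volume.restrict (Set.Ioo 0 T)),
        ∫⁻ x, ‖∫ y, θ τ y * ⟪W τ x - W τ y,
          FunctionSpaces.Torus.gradient (FunctionSpaces.Torus.kernel (ε n)) (x - y)⟫_ℝ‖ₑ ≤ K) ∧
      Tendsto (fun n => ∫ τ in Set.Ioo 0 T, (∫⁻ x, ‖∫ y, θ τ y * ⟪W τ x - W τ y,
          FunctionSpaces.Torus.gradient (FunctionSpaces.Torus.kernel (ε n)) (x - y)⟫_ℝ‖ₑ).toReal)
        atTop (𝓝 0) := by
  set μT : Measure ℝ := (volume : Measure ℝ).restrict (Set.Ioo 0 T) with hμT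
  haveI : IsFiniteMeasure μT := by rw [hμT]; infer_instance
  obtain ⟨C₁, hC₁⟩ := h.exists_eLpNorm_le
  set kk : ℕ → UnitAddTorus d → ℝ := fun n => FunctionSpaces.Torus.kernel (d := d) (ε n) with hkk
  have hkS : ∀ n, FunctionSpaces.Torus.IsSmooth (kk n) := fun n =>
    FunctionSpaces.Torus.isSmooth_kernel (hε n) (hε' n)
  set ρ : ℕ → ℝ → ℝ≥0∞ := fun n τ =>
    ∫⁻ x, ‖∫ y, θ τ y * ⟪W τ x - W τ y, FunctionSpaces.Torus.gradient (kk n) (x - y)⟫_ℝ‖ₑ with hρ_def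
  have hρm : ∀ n, AEMeasurable (ρ n) μT := fun n => h.aemeasurable_lintegral_enorm_comm (hkS n)
  -- `ρ ≤ ‖r‖_{L²}` slice-wise
  have hρ2 : ∀ n τ, Integrable (θ τ) volume → ρ n τ ≤
      eLpNorm (fun x => ∫ y, θ τ y * ⟪W τ x - W τ y, FunctionSpaces.Torus.gradient (kk n) (x - y)⟫_ℝ) 2 volume := by
    intro n τ hθi
    have hc := continuous_comm hθi (hW τ).continuous (hkS n)
    calc ρ n τ = eLpNorm (fun x => ∫ y, θ τ y * ⟪W τ x - W τ y, FunctionSpaces.Torus.gradient (kk n) (x - y)⟫_ℝ) 1 volume := by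
          rw [eLpNorm_one_eq_lintegral_enorm]
      _ ≤ _ := eLpNorm_le_eLpNorm_of_exponent_le (by norm_num) hc.aestronglyMeasurable
  set K : ℝ≥0 := Real.toNNReal (L * FunctionSpaces.Torus.gradProfileMass d) * C₁ with hK
  have hρle : ∀ n, ∀ᵐ τ ∂μT, ρ n τ ≤ K := by
    intro n
    filter_upwards [h.ae_memLp_two, hC₁] with τ hθ2 hθC
    have hθi : Integrable (θ τ) volume := hθ2.integrable one_le_two
    calc ρ n τ ≤ _ := hρ2 n τ hθi
      _ ≤ ENNReal.ofReal (L * FunctionSpaces.Torus.gradProfileMass d) * eLpNorm (θ τ) 2 volume :=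
          eLpNorm_comm_le (hW τ) hθi (hε n) (hε' n)
      _ ≤ ENNReal.ofReal (L * FunctionSpaces.Torus.gradProfileMass d) * C₁ := by gcongr
      _ = K := by rw [hK, ENNReal.coe_mul]; rfl
  have hρ0 : ∀ᵐ τ ∂μT, Tendsto (fun n => ρ n τ) atTop (𝓝 0) := by
    filter_upwards [h.ae_memLp_two, h.ae_isWeaklyDivFree] with τ hθ2 hdiv
    exact tendsto_of_tendsto_of_tendsto_of_le_of_le tendsto_const_nhds
      (tendsto_eLpNorm_comm (hW τ) hdiv hθ2 hε hε' hε0) (fun n => zero_le)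
      fun n => hρ2 n τ (hθ2.integrable one_le_two)
  refine ⟨K, hρle, ?_⟩
  have hlim := tendsto_integral_of_dominated_convergence (μ := μT) (F := fun n τ => (ρ n τ).toReal)
    (f := fun _ => (0 : ℝ)) (fun _ => (K : ℝ)) (fun n => (hρm n).ennreal_toReal.aestronglyMeasurable)
    (integrable_const _) (fun n => ?_) ?_
  · simpa using hlim
  · filter_upwards [hρle n] with τ hτ
    rw [Real.norm_eq_abs, abs_of_nonneg ENNReal.toReal_nonneg]
    exact ENNReal.toReal_le_coe_of_le_coe hτ
  · filter_upwards [hρ0] with τ hτ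
    have h0 : Tendsto (fun n => (ρ n τ).toReal) atTop (𝓝 (0 : ℝ≥0∞).toReal) :=
      (ENNReal.tendsto_toReal ENNReal.zero_ne_top).comp hτ
    rwa [ENNReal.toReal_zero] at h0

/-! ## The conservative balance -/

/-- **Conservative energy balance of the sourced transport equation with Lipschitz drift**
(DiPerna–Lions 1989, §II.3, Thm. II.3, in the Lipschitz setting; any dimension): for `T > 0`, a
smooth steady source `f`, `θ₀ ∈ L²(T^d)`, a drift `W` that is `L`-Lipschitz in space at every time
and a weak solution `θ ∈ L^∞(0,T;L²)` of `∂ₜθ + W·∇θ = f` on `T^d × [0,T)` (the class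
`IsWeakScalarTransportForcedOn T 0 W (fun _ => f) θ₀ θ`, which contains the weak
incompressibility of `W(t)` for a.e. `t`), for a.e. `t ∈ (0,T)`:
`∫ θ(t,x)² dx = ∫ θ₀² dx + 2 ∫_{(0,t]} ∫ θ(τ,x) f(x) dx dτ`.
[cite: DiPernaLions1989, §II.3 Thm. II.3] -/
theorem integral_sq_eq_of_lipschitzWith {T : ℝ} {L : ℝ≥0} {W : ℝ → UnitAddTorus d → EuclideanSpace ℝ d}
    {f θ₀ : UnitAddTorus d → ℝ} {θ : ℝ → UnitAddTorus d → ℝ} (hf : FunctionSpaces.Torus.IsSmooth f)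
    (hθ₀ : MemLp θ₀ 2 volume) (hW : ∀ t, LipschitzWith L (W t))
    (h : IsWeakScalarTransportForcedOn T 0 W (fun _ => f) θ₀ θ) :
    ∀ᵐ t ∂(volume.restrict (Set.Ioo 0 T)),
      ∫ x, θ t x ^ 2 = (∫ x, θ₀ x ^ 2) + 2 * ∫ τ in Set.Ioc 0 t, ∫ x, θ τ x * f x := by
  set μT : Measure ℝ := (volume : Measure ℝ).restrict (Set.Ioo 0 T) with hμT
  haveI : IsFiniteMeasure μT := by rw [hμT]; infer_instance
  -- radii, kernels, mollification
  obtain ⟨hε, hε', hε0⟩ := molRadius_spec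
  set ε : ℕ → ℝ := fun n => 1 / (4 * ((n : ℝ) + 1)) with hε_def
  set kk : ℕ → UnitAddTorus d → ℝ := fun n => FunctionSpaces.Torus.kernel (d := d) (ε n) with hkk
  have hkS : ∀ n, FunctionSpaces.Torus.IsSmooth (kk n) := fun n =>
    FunctionSpaces.Torus.isSmooth_kernel (hε n) (hε' n)
  have hconv : ∀ (δ : UnitAddTorus d → ℝ) (n : ℕ) (x : UnitAddTorus d), (δ ⋆ kk n) x = ∫ y, δ y * kk n (x - y) :=
    fun δ n x => by simp only [convolution_lsmul, smul_eq_mul]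
  have hE0 : ∀ {g : UnitAddTorus d → ℝ}, MemLp g 2 volume →
      Tendsto (fun n => eLpNorm (g ⋆ kk n - g) 2 volume) atTop (𝓝 0) := fun hg =>
    FunctionSpaces.Torus.tendsto_eLpNorm_convolution_sub_self hg
      (fun n y => FunctionSpaces.Torus.kernel_nonneg (hε n).le y)
      (fun n => FunctionSpaces.Torus.integral_kernel (hε n) (hε' n))
      (fun n => FunctionSpaces.Torus.support_kernel_subset (hε n))
      (fun n => FunctionSpaces.Torus.continuous_kernel (hε n) (hε' n)) hε0
  have hθ₀i : Integrable θ₀ volume := hθ₀.integrable one_le_two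
  -- good slices
  obtain ⟨C₁, hC₁⟩ := h.exists_eLpNorm_le
  have hgood : ∀ᵐ s ∂μT, (Integrable (θ s) volume ∧ Integrable (fun y => ‖W s y‖ * θ s y) volume) ∧
      FunctionSpaces.Torus.IsWeaklyDivFree (W s) ∧ MemLp (θ s) 2 volume := by
    filter_upwards [h.ae_slice_integrable₁, h.ae_isWeaklyDivFree, h.ae_memLp_two] with s h1 h2 h3
    exact ⟨⟨h1.1, h1.2.2.1⟩, h2, h3⟩
  -- the commutator
  obtain ⟨Kρ, hρle, hP0⟩ := h.comm_decay_of_lipschitzWith hW hε hε' hε0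
  set ρ : ℕ → ℝ → ℝ≥0∞ := fun n s =>
    ∫⁻ x, ‖∫ y, θ s y * ⟪W s x - W s y, FunctionSpaces.Torus.gradient (kk n) (x - y)⟫_ℝ‖ₑ with hρ_def
  set Pn : ℕ → ℝ := fun n => ∫ s, (ρ n s).toReal ∂μT with hPn_def
  have hρi : ∀ n, Integrable (fun s => (ρ n s).toReal) μT := fun n =>
    Integrable.mono' (integrable_const (Kρ : ℝ))
      (h.aemeasurable_lintegral_enorm_comm (hkS n)).ennreal_toReal.aestronglyMeasurable
      ((hρle n).mono fun s hs => by
        rw [Real.norm_eq_abs, abs_of_nonneg ENNReal.toReal_nonneg]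
        exact ENNReal.toReal_le_coe_of_le_coe hs)
  -- the renormalisers `β_M`, `M ∈ ℕ`
  set Cβ : ℕ → ℝ := fun M => 4 * ((Calculus.truncCutoff (M : ℝ)).rIn + 1) with hCβ
  have hCβ0 : ∀ M, 0 ≤ Cβ M := fun M => by
    have := (Calculus.truncCutoff (M : ℝ)).rIn_pos; simp only [hCβ]; positivity
  have hβ'b : ∀ (M : ℕ) (y : ℝ), |deriv (Calculus.renorm (M : ℝ)) y| ≤ Cβ M := fun M y => by
    rw [Calculus.deriv_renorm]; exact Calculus.abs_renormDeriv_le_const _ y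
  -- the terms of the identity
  set LHS : ℕ → ℕ → ℝ → ℝ := fun M n t =>
    ∫ x, Calculus.renorm (M : ℝ) (∫ y, θ t y * kk n (x - y)) with hLHS
  set Dat : ℕ → ℕ → ℝ := fun M n =>
    ∫ x, Calculus.renorm (M : ℝ) (∫ y, θ₀ y * kk n (x - y)) with hDat
  set Src : ℕ → ℕ → ℝ → ℝ := fun M n t => ∫ τ in Set.Ioc 0 t, ∫ x,
    Calculus.renormDeriv (M : ℝ) (∫ y, θ τ y * kk n (x - y)) * ∫ y, f y * kk n (x - y) with hSrc
  set SrcM : ℕ → ℝ → ℝ := fun M t =>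
    ∫ τ in Set.Ioc 0 t, ∫ x, Calculus.renormDeriv (M : ℝ) (θ τ x) * f x with hSrcM
  -- ### the core estimate: `|LHS - Dat - Src| ≤ Cβ_M Pₙ` at a.e. `t`, for each `M`, `n`
  have hcore : ∀ M n : ℕ, ∀ᵐ t ∂μT, |LHS M n t - Dat M n - Src M n t| ≤ Cβ M * Pn n := by
    intro M n
    have hβtop := Calculus.contDiff_renorm (M : ℝ)
    have hβ : ContDiff ℝ 1 (Calculus.renorm (M : ℝ)) := hβtop.of_le (by simp)
    have hβK := Calculus.lipschitzWith_renorm (M : ℝ)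
    have hβ'c : Continuous (deriv (Calculus.renorm (M : ℝ))) := hβ.continuous_deriv le_rfl
    set Φ : ℝ → ℝ := fun s => ∫ x, deriv (Calculus.renorm (M : ℝ)) (∫ y, θ s y * kk n (x - y)) *
      ((∫ y, θ s y * (-⟪W s y, FunctionSpaces.Torus.gradient (kk n) (x - y)⟫_ℝ +
          0 * FunctionSpaces.Torus.laplacian (kk n) (x - y))) + ∫ y, f y * kk n (x - y)) with hΦ_def
    have hΦi : Integrable Φ μT := (h.integrable_comp_molInt_mul_flux (hkS n) hβ'c (hβ'b M)).integral_prod_left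
    set Q : ℝ → ℝ := fun τ =>
      ∫ x, Calculus.renormDeriv (M : ℝ) (∫ y, θ τ y * kk n (x - y)) * ∫ y, f y * kk n (x - y) with hQ_def
    have hQi : Integrable Q μT := h.integrable_integral_renormDeriv_molInt_mul_sourceMol hf (hkS n) (M : ℝ)
    -- the slice identity `Φ - Q = ∫ β'(Aₙ) rₙ` and the bound `|Φ - Q| ≤ Cβ ρₙ`, a.e. in `s`
    have hslice : ∀ᵐ s ∂μT, |Φ s - Q s| ≤ Cβ M * (ρ n s).toReal := by
      filter_upwards [hgood, hρle n] with s hs hρs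
      obtain ⟨⟨hθi, huθ⟩, hdiv, -⟩ := hs
      have hWc : Continuous (W s) := (hW s).continuous
      have hid := integral_deriv_comp_mul_flux_eq hβtop hθi hWc.integrable_unitAddTorus huθ hdiv (hkS n) 0
      have hid' : (∫ x, deriv (Calculus.renorm (M : ℝ)) ((θ s ⋆ kk n) x) *
          ∫ y, θ s y * (-⟪W s y, FunctionSpaces.Torus.gradient (kk n) (x - y)⟫_ℝ +
            0 * FunctionSpaces.Torus.laplacian (kk n) (x - y))) =
          ∫ x, deriv (Calculus.renorm (M : ℝ)) ((θ s ⋆ kk n) x) *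
            ∫ y, θ s y * ⟪W s x - W s y, FunctionSpaces.Torus.gradient (kk n) (x - y)⟫_ℝ := by
        rw [hid]; ring
      have hA : FunctionSpaces.Torus.IsSmooth (θ s ⋆ kk n) :=
        FunctionSpaces.Torus.isSmooth_convolution hθi (hkS n)
      have hbc : Continuous fun x => deriv (Calculus.renorm (M : ℝ)) ((θ s ⋆ kk n) x) := hβ'c.comp hA.continuous
      have hGc := continuous_fluxIntegral hθi hWc.aestronglyMeasurable huθ (hkS n) 0
      have hSc : Continuous fun x => ∫ y, f y * kk n (x - y) := by
        rw [show (fun x => ∫ y, f y * kk n (x - y)) = f ⋆ kk n from funext fun x => (hconv f n x).symm]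
        exact FunctionSpaces.Torus.continuous_convolution hf.continuous.integrable_unitAddTorus (hkS n).continuous
      have jG : Integrable (fun x => deriv (Calculus.renorm (M : ℝ)) ((θ s ⋆ kk n) x) *
          ∫ y, θ s y * (-⟪W s y, FunctionSpaces.Torus.gradient (kk n) (x - y)⟫_ℝ +
            0 * FunctionSpaces.Torus.laplacian (kk n) (x - y))) volume := (hbc.mul hGc).integrable_unitAddTorus
      have jS : Integrable (fun x => deriv (Calculus.renorm (M : ℝ)) ((θ s ⋆ kk n) x) *
          ∫ y, f y * kk n (x - y)) volume :=
        (hbc.mul hSc).integrable_unitAddTorus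
      have e1 : Φ s = ∫ x, (deriv (Calculus.renorm (M : ℝ)) ((θ s ⋆ kk n) x) *
          (∫ y, θ s y * (-⟪W s y, FunctionSpaces.Torus.gradient (kk n) (x - y)⟫_ℝ +
            0 * FunctionSpaces.Torus.laplacian (kk n) (x - y))) +
          deriv (Calculus.renorm (M : ℝ)) ((θ s ⋆ kk n) x) * ∫ y, f y * kk n (x - y)) := by
        simp only [hΦ_def, hconv, mul_add]
      have e3 : Q s = ∫ x, deriv (Calculus.renorm (M : ℝ)) ((θ s ⋆ kk n) x) * ∫ y, f y * kk n (x - y) := by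
        simp only [hQ_def, Calculus.deriv_renorm, hconv]
      have e : Φ s - Q s = ∫ x, deriv (Calculus.renorm (M : ℝ)) ((θ s ⋆ kk n) x) *
          ∫ y, θ s y * ⟪W s x - W s y, FunctionSpaces.Torus.gradient (kk n) (x - y)⟫_ℝ := by
        rw [e1, integral_add jG jS, hid', e3, add_sub_cancel_right]
      rw [e]
      exact IsWeakScalarTransportOn.abs_integral_mul_le_mul_toReal_lintegral (fun x => hβ'b M _)
        (continuous_comm hθi hWc (hkS n)).aestronglyMeasurable (hρs.trans_lt ENNReal.coe_lt_top)
    -- the good times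
    filter_upwards [h.ae_integral_comp_molInt_eq hθ₀i (hkS n) hβ hβK, ae_restrict_mem measurableSet_Ioo]
      with t hid htT
    have hsub : Set.Ioc 0 t ⊆ Set.Ioo 0 T := Set.Ioc_subset_Ioo_right htT.2
    have hle : (volume : Measure ℝ).restrict (Set.Ioc 0 t) ≤ μT := Measure.restrict_mono_set _ hsub
    have hidΦ : LHS M n t = Dat M n + ∫ s in Set.Ioc 0 t, Φ s := by simpa only using hid
    have hdiff : LHS M n t - Dat M n - Src M n t = ∫ s in Set.Ioc 0 t, (Φ s - Q s) := by
      rw [hidΦ, integral_sub (hΦi.mono_measure hle) (hQi.mono_measure hle)]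
      have : Src M n t = ∫ s in Set.Ioc 0 t, Q s := rfl
      rw [this]; ring
    rw [hdiff]
    calc |∫ s in Set.Ioc 0 t, (Φ s - Q s)| ≤ ∫ s in Set.Ioc 0 t, Cβ M * (ρ n s).toReal := by
          rw [← Real.norm_eq_abs]
          exact norm_integral_le_of_norm_le (((hρi n).mono_measure hle).const_mul _)
            (ae_restrict_of_ae_restrict_of_subset hsub (hslice.mono fun s hs => by rwa [Real.norm_eq_abs]))
      _ = Cβ M * ∫ s in Set.Ioc 0 t, (ρ n s).toReal := MeasureTheory.integral_const_mul _ _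
      _ ≤ Cβ M * Pn n := mul_le_mul_of_nonneg_left
          (integral_mono_measure hle (Eventually.of_forall fun s => ENNReal.toReal_nonneg) (hρi n)) (hCβ0 M)
  -- ### assembly at a.e. `t`: `n → ∞` for each `M`, then `M → ∞`
  have hcore' : ∀ᵐ t ∂μT, ∀ M n : ℕ, |LHS M n t - Dat M n - Src M n t| ≤ Cβ M * Pn n :=
    ae_all_iff.2 fun M => ae_all_iff.2 fun n => hcore M n
  filter_upwards [hcore', hgood, ae_restrict_mem measurableSet_Ioo] with t hct hg htT
  obtain ⟨⟨hθi, -⟩, -, hθ2⟩ := hg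
  have hM : ∀ M : ℕ, ∫ x, Calculus.renorm (M : ℝ) (θ t x) =
      (∫ x, Calculus.renorm (M : ℝ) (θ₀ x)) + SrcM M t := by
    intro M
    have hβK := Calculus.lipschitzWith_renorm (M : ℝ)
    have h1 : Tendsto (fun n => LHS M n t) atTop (𝓝 (∫ x, Calculus.renorm (M : ℝ) (θ t x))) := by
      have e : (fun n => LHS M n t) = fun n => ∫ x, Calculus.renorm (M : ℝ) ((θ t ⋆ kk n) x) :=
        funext fun n => by simp only [hLHS, hconv]
      rw [e]
      exact tendsto_integral_comp_of_lipschitzWith hβK hθ2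
        (fun n => (FunctionSpaces.Torus.isSmooth_convolution hθi (hkS n)).memLp 2) (hE0 hθ2)
    have h2 : Tendsto (fun n => Dat M n) atTop (𝓝 (∫ x, Calculus.renorm (M : ℝ) (θ₀ x))) := by
      have e : (fun n => Dat M n) = fun n => ∫ x, Calculus.renorm (M : ℝ) ((θ₀ ⋆ kk n) x) :=
        funext fun n => by simp only [hDat, hconv]
      rw [e]
      exact tendsto_integral_comp_of_lipschitzWith hβK hθ₀
        (fun n => (FunctionSpaces.Torus.isSmooth_convolution hθ₀i (hkS n)).memLp 2) (hE0 hθ₀)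
    have h3 : Tendsto (fun n => Src M n t) atTop (𝓝 (SrcM M t)) :=
      h.tendsto_setIntegral_renormDeriv_molInt_mul_sourceMol hf hε hε' hε0 (M : ℝ) htT
    have h4 : Tendsto (fun n => Cβ M * Pn n) atTop (𝓝 0) := by
      have := hP0.const_mul (Cβ M)
      rwa [mul_zero] at this
    have h5 :
        |(∫ x, Calculus.renorm (M : ℝ) (θ t x)) - (∫ x, Calculus.renorm (M : ℝ) (θ₀ x)) - SrcM M t| ≤ 0 :=
      le_of_tendsto_of_tendsto' ((h1.sub h2).sub h3).abs h4 fun n => hct M n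
    linarith [abs_nonpos_iff.1 h5]
  have hL : Tendsto (fun M : ℕ => ∫ x, Calculus.renorm (M : ℝ) (θ t x)) atTop (𝓝 (∫ x, θ t x ^ 2)) :=
    tendsto_integral_renorm_atTop hθ2
  have hR : Tendsto (fun M : ℕ => (∫ x, Calculus.renorm (M : ℝ) (θ₀ x)) + SrcM M t) atTop
      (𝓝 ((∫ x, θ₀ x ^ 2) + 2 * ∫ τ in Set.Ioc 0 t, ∫ x, θ τ x * f x)) :=
    (tendsto_integral_renorm_atTop hθ₀).add (h.tendsto_setIntegral_renormDeriv_mul_source hf htT)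
  exact tendsto_nhds_unique hL (hR.congr fun M => (hM M).symm)

end IsWeakScalarTransportForcedOn

end Torus

end Literature.Analysis.FluidPDE
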